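import Summits.Ventures.PercRepro.S1CFCapsFourThree
import Summits.Ventures.PercRepro.S1CFCapsLine

/-!
# PercRepro — THE CAPS OF A SIMPLE COLOOP-FREE MATROID OF NULLITY `4` ON ANY `n ≥ 10` POINTS (p1, gen 37)

For the contractions `N = M ／ W` at `w ≤ 8` of p7's ν = 4 program (`13 … 15` points, SIMPLE by the spread thresholds):
for `N` loopless, coloop-free, `|E| = rank + 4`, `|E| ≥ 10` and WITHOUT dependent pairs,
* **`ncard_dep_four_le_split_general`** — `D₄ ≤ C(n − 2, 2)·D₂ + (n − 3)·c₃ + c₄` for any `n`;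
* **`ncard_dep_three_le_sixteen_of_no_dep_pair`** — `D₃ = c₃ ≤ 16`;
* **`ncard_four_eRk_le_two_le_five_of_no_dep_pair`** — `Q₄² ≤ 5` (the `4`-sets of rank `≤ 2` lie in one line of `≤ 5` points);
* **`ncard_dep_four_le_of_no_dep_pair`** — `D₄ ≤ 16·(n − 3) + 35` (`195 / 211 / 227` at `n = 13 / 14 / 15`);
and trivially `D₂ = Q₃¹ = Q₄¹ = 0` (**`ncard_three_eRk_le_one_eq_zero_of_no_dep_pair`**, **`ncard_four_eRk_le_one_eq_zero_of_no_dep_pair`**).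
Nothing about any cell is claimed. Axioms: standard.
-/

open scoped Matroid

namespace PercRepro

namespace S1CF

open Set

variable {α : Type}

/-- **`D₄ ≤ C(n − 2, 2)·D₂ + (n − 3)·c₃ + c₄`** for any number `n` of points. -/
theorem ncard_dep_four_le_split_general (M : Matroid α) [M.Finite] :
    {X : Set α | X ⊆ M.E ∧ X.ncard = 4 ∧ M.Dep X}.ncard ≤
      (M.E.ncard - 2).choose 2 * {P : Set α | P ⊆ M.E ∧ P.ncard = 2 ∧ M.Dep P}.ncard +
        (M.E.ncard - 3) * {C : Set α | C ⊆ M.E ∧ M.IsCircuit C ∧ C.ncard = 3}.ncard +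
          {C : Set α | C ⊆ M.E ∧ M.IsCircuit C ∧ C.ncard = 4}.ncard := by
  classical
  have hEfin := M.ground_finite
  set A := {X : Set α | X ⊆ M.E ∧ X.ncard = 4 ∧ ∃ P ⊆ X, P.ncard = 2 ∧ M.Dep P} with hA
  set B := {X : Set α | X ⊆ M.E ∧ X.ncard = 4 ∧
    ∃ T ∈ {C : Set α | C ⊆ M.E ∧ M.IsCircuit C ∧ C.ncard = 3}, T ⊆ X} with hB
  set C4 := {C : Set α | C ⊆ M.E ∧ M.IsCircuit C ∧ C.ncard = 4} with hC4
  have hAfin : A.Finite := hEfin.finite_subsets.subset (fun X hX => hX.1)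
  have hBfin : B.Finite := hEfin.finite_subsets.subset (fun X hX => hX.1)
  have hCfin : C4.Finite := hEfin.finite_subsets.subset (fun X hX => hX.1)
  have hsplit : {X : Set α | X ⊆ M.E ∧ X.ncard = 4 ∧ M.Dep X} ⊆ A ∪ B ∪ C4 := by
    intro X hX
    obtain ⟨hXE, hX4, hXdep⟩ := hX
    by_cases h2 : ∃ P ⊆ X, P.ncard = 2 ∧ M.Dep P
    · exact Or.inl (Or.inl ⟨hXE, hX4, h2⟩)
    by_cases h3 : ∃ T ⊆ X, M.IsCircuit T ∧ T.ncard = 3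
    · obtain ⟨T, hTX, hTc, hT3⟩ := h3
      exact Or.inl (Or.inr ⟨hXE, hX4, T, ⟨hTX.trans hXE, hTc, hT3⟩, hTX⟩)
    push Not at h2 h3
    exact Or.inr ⟨hXE, isCircuit_of_dep_four_of_no_dep_pair_of_no_triangle M hXE hX4 hXdep h2
      (fun T hT hTc hT3 => h3 T hT hTc hT3), hX4⟩
  have hAle := ncard_with_dep_pair_le M 4
  have hBle : B.ncard ≤ (M.E.ncard - 3) * {C : Set α | C ⊆ M.E ∧ M.IsCircuit C ∧ C.ncard = 3}.ncard := by
    have := ncard_with_member_le hEfin {C : Set α | C ⊆ M.E ∧ M.IsCircuit C ∧ C.ncard = 3} 3 4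
      (fun T hT => ⟨hT.1, hT.2.2⟩)
    rw [show (4 : ℕ) - 3 = 1 by norm_num, Nat.choose_one_right] at this
    exact this
  calc {X : Set α | X ⊆ M.E ∧ X.ncard = 4 ∧ M.Dep X}.ncard
      ≤ (A ∪ B ∪ C4).ncard := Set.ncard_le_ncard hsplit ((hAfin.union hBfin).union hCfin)
    _ ≤ (A ∪ B).ncard + C4.ncard := Set.ncard_union_le _ _
    _ ≤ A.ncard + B.ncard + C4.ncard := by gcongr; exact Set.ncard_union_le _ _
    _ ≤ _ := by gcongr

/-- **`D₃ ≤ 16` without dependent pairs**: the dependent `3`-sets are the triangles. -/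
theorem ncard_dep_three_le_sixteen_of_no_dep_pair (M : Matroid α) [M.Finite] (hL : ∀ e ∈ M.E, ¬ M.IsLoop e)
    (hK : ∀ e, ¬ M.IsColoop e) (hd : M.E.encard = M.eRank + ((4 : ℕ) : ℕ∞)) (hn : 10 ≤ M.E.ncard)
    (h0 : {P : Set α | P ⊆ M.E ∧ P.ncard = 2 ∧ M.Dep P}.ncard = 0) :
    {X : Set α | X ⊆ M.E ∧ X.ncard = 3 ∧ M.Dep X}.ncard ≤ 16 := by
  have hEfin := M.ground_finite
  have hno : ∀ P, P ⊆ M.E → P.ncard = 2 → ¬ M.Dep P := by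
    intro P hPE hP2 hPdep
    have : P ∈ {P : Set α | P ⊆ M.E ∧ P.ncard = 2 ∧ M.Dep P} := ⟨hPE, hP2, hPdep⟩
    rw [Set.ncard_eq_zero (hEfin.finite_subsets.subset (fun P hP => hP.1))] at h0
    rw [h0] at this
    exact this
  have hsub : {X : Set α | X ⊆ M.E ∧ X.ncard = 3 ∧ M.Dep X} ⊆
      {C : Set α | C ⊆ M.E ∧ M.IsCircuit C ∧ C.ncard = 3} := by
    intro X hX
    obtain ⟨hXE, hX3, hXdep⟩ := hX
    exact ⟨hXE, isCircuit_of_dep_three_of_no_dep_pair M hXE hX3 hXdep (fun P hP hP2 => hno P (hP.trans hXE) hP2), hX3⟩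
  exact (Set.ncard_le_ncard hsub (hEfin.finite_subsets.subset (fun X hX => hX.1))).trans
    (ncard_triangles_le_sixteen M hL hK hd hn)

/-- **`Q₄² ≤ 5` without dependent pairs** (any `n ≥ 10`): the `4`-sets of rank `≤ 2` lie in one line of `≤ 5` points. -/
theorem ncard_four_eRk_le_two_le_five_of_no_dep_pair (M : Matroid α) [M.Finite] (hL : ∀ e ∈ M.E, ¬ M.IsLoop e)
    (hK : ∀ e, ¬ M.IsColoop e) (hd : M.E.encard = M.eRank + ((4 : ℕ) : ℕ∞)) (hn : 10 ≤ M.E.ncard)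
    (h0 : {P : Set α | P ⊆ M.E ∧ P.ncard = 2 ∧ M.Dep P}.ncard = 0) :
    {X : Set α | X ⊆ M.E ∧ X.ncard = 4 ∧ M.eRk X ≤ 2}.ncard ≤ 5 := by
  classical
  have hEfin := M.ground_finite
  have hno : ∀ P, P ⊆ M.E → P.ncard = 2 → ¬ M.Dep P := by
    intro P hPE hP2 hPdep
    have : P ∈ {P : Set α | P ⊆ M.E ∧ P.ncard = 2 ∧ M.Dep P} := ⟨hPE, hP2, hPdep⟩
    rw [Set.ncard_eq_zero (hEfin.finite_subsets.subset (fun P hP => hP.1))] at h0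
    rw [h0] at this
    exact this
  have h8 : 6 ≤ (M.eRk M.E).toNat := by
    have := ncard_ground_eq_eRk_toNat_add M hd
    omega
  set 𝒬 := {X : Set α | X ⊆ M.E ∧ X.ncard = 4 ∧ M.eRk X ≤ 2} with h𝒬
  rcases 𝒬.eq_empty_or_nonempty with hemp | ⟨X₀, hX₀⟩
  · rw [hemp]; simp
  obtain ⟨hX₀E, hX₀4, hX₀r⟩ := hX₀
  have hX₀fin : X₀.Finite := hEfin.subset hX₀E
  obtain ⟨u, hu⟩ : X₀.Nonempty := by rw [← Set.ncard_pos hX₀fin, hX₀4]; norm_num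
  obtain ⟨v, hv, hvu⟩ := Set.exists_ne_of_one_lt_ncard (by rw [hX₀4]; norm_num) u
  have huv : ({u, v} : Set α) ⊆ X₀ := by intro w hw; rcases hw with rfl | rfl; exacts [hu, hv]
  have hind : M.Indep {u, v} := by
    rw [← Matroid.not_dep_iff (huv.trans hX₀E)]
    exact hno _ (huv.trans hX₀E) (Set.ncard_pair (Ne.symm hvu))
  set L := M.closure {u, v} with hLdef
  have hLE : L ⊆ M.E := M.closure_subset_ground _
  have hLfin : L.Finite := hEfin.subset hLE
  have hLr : M.eRk L ≤ 2 := by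
    rw [hLdef, M.eRk_closure_eq, hind.eRk_eq_encard, Set.encard_pair (Ne.symm hvu)]
  have hLr' := eRk_toNat_le_of_eRk_le M hLE (m := 2) (by exact_mod_cast hLr)
  have hL5 : L.ncard ≤ 5 := by
    have := ncard_le_eRk_toNat_add_three_of_lt M hK hd hLE (by omega)
    omega
  have hX₀L : X₀ ⊆ L := by
    intro w hw
    by_cases hwuv : w ∈ ({u, v} : Set α)
    · exact M.subset_closure _ (huv.trans hX₀E) hwuv
    · have hdep : M.Dep (insert w {u, v}) := by
        have hsub : insert w {u, v} ⊆ X₀ := Set.insert_subset hw huv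
        have hfin : (insert w {u, v} : Set α).Finite := hX₀fin.subset hsub
        rw [← Matroid.eRk_lt_encard_iff_dep_of_finite hfin (hsub.trans hX₀E),
          Set.encard_insert_of_notMem hwuv, Set.encard_pair (Ne.symm hvu)]
        calc M.eRk (insert w {u, v}) ≤ M.eRk X₀ := M.eRk_mono hsub
          _ ≤ 2 := hX₀r
          _ < 2 + 1 := by norm_num
      rw [hind.insert_dep_iff] at hdep
      exact hdep.1
  have hsub : 𝒬 ⊆ {X : Set α | X ⊆ L ∧ X.ncard = 4} := by
    intro X hX
    obtain ⟨hXE, hX4, hXr⟩ := hX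
    refine ⟨?_, hX4⟩
    have hXfin : X.Finite := hEfin.subset hXE
    have hU : X₀ ∪ X ⊆ M.E := union_subset hX₀E hXE
    have hUr : M.eRk (X₀ ∪ X) + M.eRk (X₀ ∩ X) ≤ 4 := by
      have := M.eRk_inter_add_eRk_union_le X₀ X
      calc M.eRk (X₀ ∪ X) + M.eRk (X₀ ∩ X) = M.eRk (X₀ ∩ X) + M.eRk (X₀ ∪ X) := add_comm _ _
        _ ≤ M.eRk X₀ + M.eRk X := this
        _ ≤ 2 + 2 := add_le_add hX₀r hXr
        _ = 4 := by norm_num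
    have hUcard := Set.ncard_union_add_ncard_inter X₀ X hX₀fin hXfin
    by_cases hI3 : 3 ≤ (X₀ ∩ X).ncard
    · obtain ⟨a, ha⟩ : (X₀ ∩ X).Nonempty := by
        rw [← Set.ncard_pos (hX₀fin.subset inter_subset_left)]; omega
      obtain ⟨b, hb, hba⟩ := Set.exists_ne_of_one_lt_ncard (by omega : 1 < (X₀ ∩ X).ncard) a
      have hab : ({a, b} : Set α) ⊆ X₀ ∩ X := by intro w hw; rcases hw with rfl | rfl; exacts [ha, hb]
      have habind : M.Indep {a, b} := by
        rw [← Matroid.not_dep_iff ((hab.trans inter_subset_left).trans hX₀E)]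
        exact hno _ ((hab.trans inter_subset_left).trans hX₀E) (Set.ncard_pair (Ne.symm hba))
      have hcl : M.closure {a, b} = L := by
        apply le_antisymm
        · exact M.closure_subset_closure_of_subset_closure ((hab.trans inter_subset_left).trans hX₀L)
        · by_contra hne
          obtain ⟨z, hzL, hzcl⟩ := Set.not_subset.1 hne
          have hzE : z ∈ M.E := hLE hzL
          have hind' : M.Indep (insert z {a, b}) := by
            rw [habind.insert_indep_iff_of_notMem (fun h => hzcl (M.subset_closure _
              ((hab.trans inter_subset_left).trans hX₀E) h))]
            exact ⟨hzE, hzcl⟩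
          have h3 : M.eRk (insert z {a, b}) = 3 := by
            rw [hind'.eRk_eq_encard, Set.encard_insert_of_notMem (fun h => hzcl (M.subset_closure _
              ((hab.trans inter_subset_left).trans hX₀E) h)), Set.encard_pair (Ne.symm hba)]
            norm_num
          have hle : M.eRk (insert z {a, b}) ≤ M.eRk L :=
            M.eRk_mono (Set.insert_subset hzL ((hab.trans inter_subset_left).trans hX₀L))
          rw [h3] at hle
          have : (3 : ℕ∞) ≤ 2 := hle.trans hLr
          norm_num at this
      rw [← hcl]
      intro w hw
      by_cases hwab : w ∈ ({a, b} : Set α)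
      · exact M.subset_closure _ ((hab.trans inter_subset_right).trans hXE) hwab
      · have hdep : M.Dep (insert w {a, b}) := by
          have hsub' : insert w {a, b} ⊆ X := Set.insert_subset hw (hab.trans inter_subset_right)
          have hfin : (insert w {a, b} : Set α).Finite := hXfin.subset hsub'
          rw [← Matroid.eRk_lt_encard_iff_dep_of_finite hfin (hsub'.trans hXE),
            Set.encard_insert_of_notMem hwab, Set.encard_pair (Ne.symm hba)]
          calc M.eRk (insert w {a, b}) ≤ M.eRk X := M.eRk_mono hsub'
            _ ≤ 2 := hXr
            _ < 2 + 1 := by norm_num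
        rw [habind.insert_dep_iff] at hdep
        exact hdep.1
    · exfalso
      push Not at hI3
      have hUr' : (M.eRk (X₀ ∪ X)).toNat + (M.eRk (X₀ ∩ X)).toNat ≤ 4 := by
        have h := hUr
        rw [← S1.coe_toNat_eRk M hU, ← S1.coe_toNat_eRk M (inter_subset_left.trans hX₀E)] at h
        exact_mod_cast h
      have hnull := ncard_le_eRk_toNat_add_three_of_lt M hK hd hU (by omega)
      rcases Nat.lt_or_ge (X₀ ∩ X).ncard 2 with hlt | hge
      · rcases Nat.lt_or_ge (X₀ ∩ X).ncard 1 with h0' | h1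
        · omega
        · have hI1 : (X₀ ∩ X).ncard = 1 := by omega
          obtain ⟨a, ha⟩ := Set.ncard_eq_one.1 hI1
          have haI : a ∈ X₀ ∩ X := by rw [ha]; exact Set.mem_singleton a
          have haE : a ∈ M.E := hX₀E haI.1
          have hr1 : (M.eRk (X₀ ∩ X)).toNat = 1 := by
            rw [ha, ((Matroid.not_isLoop_iff haE).1 (hL a haE)).eRk_eq]; rfl
          omega
      · have hI2 : (X₀ ∩ X).ncard = 2 := by omega
        obtain ⟨a, b, hab', hI⟩ := Set.ncard_eq_two.1 hI2
        have habind : M.Indep {a, b} := by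
          have hsub' : ({a, b} : Set α) ⊆ X₀ := by rw [← hI]; exact inter_subset_left
          rw [← Matroid.not_dep_iff (hsub'.trans hX₀E)]
          exact hno _ (hsub'.trans hX₀E) (Set.ncard_pair hab')
        have h2 : (M.eRk (X₀ ∩ X)).toNat = 2 := by
          rw [hI, habind.eRk_eq_encard, Set.encard_pair hab']; rfl
        omega
  calc 𝒬.ncard ≤ {X : Set α | X ⊆ L ∧ X.ncard = 4}.ncard :=
        Set.ncard_le_ncard hsub (hLfin.finite_subsets.subset (fun X hX => hX.1))
    _ = L.ncard.choose 4 := ncard_subsets_eq_choose hLfin 4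
    _ ≤ (5 : ℕ).choose 4 := Nat.choose_le_choose 4 hL5
    _ = 5 := by decide

/-- **`D₄ ≤ 16·(n − 3) + 35` without dependent pairs** (any `n ≥ 10`). -/
theorem ncard_dep_four_le_of_no_dep_pair (M : Matroid α) [M.Finite] (hL : ∀ e ∈ M.E, ¬ M.IsLoop e)
    (hK : ∀ e, ¬ M.IsColoop e) (hd : M.E.encard = M.eRank + ((4 : ℕ) : ℕ∞)) (hn : 10 ≤ M.E.ncard)
    (h0 : {P : Set α | P ⊆ M.E ∧ P.ncard = 2 ∧ M.Dep P}.ncard = 0) :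
    {X : Set α | X ⊆ M.E ∧ X.ncard = 4 ∧ M.Dep X}.ncard ≤ 16 * (M.E.ncard - 3) + 35 := by
  have hs := ncard_dep_four_le_split_general M
  rw [h0, mul_zero, zero_add] at hs
  have h3 := ncard_triangles_le_sixteen M hL hK hd hn
  have h4 := ncard_fourCircuits_le_thirtyfive M hd
  calc {X : Set α | X ⊆ M.E ∧ X.ncard = 4 ∧ M.Dep X}.ncard
      ≤ (M.E.ncard - 3) * {C : Set α | C ⊆ M.E ∧ M.IsCircuit C ∧ C.ncard = 3}.ncard +
          {C : Set α | C ⊆ M.E ∧ M.IsCircuit C ∧ C.ncard = 4}.ncard := hs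
    _ ≤ (M.E.ncard - 3) * 16 + 35 := by gcongr
    _ = 16 * (M.E.ncard - 3) + 35 := by ring

/-- Without dependent pairs there is no `3`-set of rank `≤ 1`. -/
theorem ncard_three_eRk_le_one_eq_zero_of_no_dep_pair (M : Matroid α) [M.Finite]
    (h0 : {P : Set α | P ⊆ M.E ∧ P.ncard = 2 ∧ M.Dep P}.ncard = 0) :
    {X : Set α | X ⊆ M.E ∧ X.ncard = 3 ∧ M.eRk X ≤ 1}.ncard = 0 := by
  have hEfin := M.ground_finite
  rw [Set.ncard_eq_zero (hEfin.finite_subsets.subset (fun X hX => hX.1)), Set.eq_empty_iff_forall_notMem]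
  rintro X ⟨hXE, hX3, hXr⟩
  obtain ⟨a, b, c, hab, hac, hbc, rfl⟩ := Set.ncard_eq_three.1 hX3
  have hP : ({a, b} : Set α) ⊆ {a, b, c} := by intro w hw; rcases hw with rfl | rfl <;> simp
  have hdep : M.Dep {a, b} := by
    rw [← Matroid.eRk_lt_encard_iff_dep_of_finite (Set.toFinite _) (hP.trans hXE), Set.encard_pair hab]
    exact lt_of_le_of_lt ((M.eRk_mono hP).trans hXr) (by norm_num)
  have : ({a, b} : Set α) ∈ {P : Set α | P ⊆ M.E ∧ P.ncard = 2 ∧ M.Dep P} := ⟨hP.trans hXE, Set.ncard_pair hab, hdep⟩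
  rw [Set.ncard_eq_zero (hEfin.finite_subsets.subset (fun P hP => hP.1))] at h0
  rw [h0] at this
  exact this

/-- Without dependent pairs there is no `4`-set of rank `≤ 1`. -/
theorem ncard_four_eRk_le_one_eq_zero_of_no_dep_pair (M : Matroid α) [M.Finite]
    (h0 : {P : Set α | P ⊆ M.E ∧ P.ncard = 2 ∧ M.Dep P}.ncard = 0) :
    {X : Set α | X ⊆ M.E ∧ X.ncard = 4 ∧ M.eRk X ≤ 1}.ncard = 0 := by
  have hEfin := M.ground_finite
  rw [Set.ncard_eq_zero (hEfin.finite_subsets.subset (fun X hX => hX.1)), Set.eq_empty_iff_forall_notMem]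
  rintro X ⟨hXE, hX4, hXr⟩
  have hXfin : X.Finite := hEfin.subset hXE
  obtain ⟨a, ha⟩ : X.Nonempty := by rw [← Set.ncard_pos hXfin, hX4]; norm_num
  obtain ⟨b, hb, hba⟩ := Set.exists_ne_of_one_lt_ncard (by rw [hX4]; norm_num) a
  have hP : ({a, b} : Set α) ⊆ X := by intro w hw; rcases hw with rfl | rfl; exacts [ha, hb]
  have hdep : M.Dep {a, b} := by
    rw [← Matroid.eRk_lt_encard_iff_dep_of_finite (Set.toFinite _) (hP.trans hXE), Set.encard_pair (Ne.symm hba)]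
    exact lt_of_le_of_lt ((M.eRk_mono hP).trans hXr) (by norm_num)
  have : ({a, b} : Set α) ∈ {P : Set α | P ⊆ M.E ∧ P.ncard = 2 ∧ M.Dep P} :=
    ⟨hP.trans hXE, Set.ncard_pair (Ne.symm hba), hdep⟩
  rw [Set.ncard_eq_zero (hEfin.finite_subsets.subset (fun P hP => hP.1))] at h0
  rw [h0] at this
  exact this

end S1CF

end PercRepro
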